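import Summits.HodgeConjecture.CorCM.CyclotomicTwoPowerPIntegers
import HarnessLib

/-!
# A primitive `2^{a+1}`-th root of unity is not a norm from `ℤ[ζ_{2^{a+1}p}]` to the fixed ring of
# `ζ ↦ ζ^{2p−1}` when `p ≡ 2^{a+1} + 1 (mod 2^{a+2})`: the descent

COR-CM (cell `pub-hodgecm2`), binder seat b04 (gen 25), count-neutral claim CYCLIC-SEMIDIRECT-TWO-POWER, part IIIb (the
`2^{a+1}`-analogue of `CorCM/CyclotomicFourPNormDescent`; sequel of `CorCM/CyclotomicTwoPowerPIntegers`).  Mathlib only.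
KERNEL ONLY: theorems; no definition, no named fact, no `sorry`.

SETTING.  `Λ = ℤ[X]/(Φ_{2^{a+1}p})` with generator `μ`, `p ≡ 2^{a+1} + 1 (mod 2^{a+2})` prime (i.e. `v₂(p − 1) = a + 1`),
`ρ̃ : μ ↦ μ^{2p−1}` (fixes `μ_{2^{a+1}}`, inverts `μ_p`), `g = 1 + μ^{2^a}`, `η = −μ^{2^a}`, `π_R : Λ → R = 𝔽_p[X]/(X^{2^a}+1)`
(kernel `gΛ`, `R` reduced), `π_s : Λ → 𝔽_p`, `μ ↦ s` (`s^{2^a} = −1`).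

THEOREM (`descent`).  No `Z ∈ Λ`, `n ≥ 1`, `j` odd, `U ∈ Λ` with `π_s(U)` a non-zero square satisfy `Z ρ̃(Z) = n² μ^{pj} U`.
PROOF.  `π ∘ ρ̃ = π` for both reductions (`2^{a+1} ∣ 2p − 2`).  If `p ∤ n`: `x = π_s(Z)/(n̄ c)` has `x² = s^{j}`, so
`x^{2^{a+1}} = −1` and `x^{p−1} = (−1)^{(p−1)/2^{a+1}} = −1` against Fermat.  If `p ∣ n`: `π_R(Z)² = 0`, `R` reduced, so
`Z = g Z₁`; with `ρ̃(g) = g ε₂` and `p = g^{p−1} ε` peel `p − 1` factors and recurse on `n/p`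
(`π_s` of the new cofactor `= (π_s(ε₂')^{(p−1)/2} π_s(ε) c)²`).

* §1 `coprime_two_mul_sub_one`, `liftR_rho_eq`, `lift_rho_eq`, `lift_root_pow_pow`.
* §2 `peel`, `peel_iter`.
* §3 **`descent`**.

## References

* [FeinGordonSmith1971] B. Fein, B. Gordon, J. H. Smith, J. Number Theory 3 (1971), 310–315.
* [Washington1997] L. C. Washington, *Introduction to Cyclotomic Fields*, Prop. 2.8, Thm. 2.13.
-/

noncomputable section

open Polynomial

namespace Summit.HodgeConjecture.CorCM.CyclotomicTwoPowerP

variable {p a : ℕ}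

/-! ## §1 The automorphism `ρ̃ : μ ↦ μ^{2p−1}` and the reductions -/

/-- `gcd(2p − 1, 2^{a+1}p) = 1`. [folklore] -/
theorem coprime_two_mul_sub_one (hp : 0 < p) : (2 * p - 1).Coprime (2 ^ (a + 1) * p) := by
  have hodd : Odd (2 * p - 1) := by rw [Nat.odd_iff]; omega
  refine Nat.Coprime.mul_right (Nat.Coprime.pow_right _ (Nat.coprime_two_right.2 hodd)) ?_
  rw [← Nat.isCoprime_iff_coprime]
  refine ⟨-1, 2, ?_⟩
  push_cast [show 1 ≤ 2 * p by omega]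
  ring

/-- `p ≡ 1 (mod 2^{a+1})` from `p % 2^{a+2} = 2^{a+1} + 1`. [folklore] -/
theorem exists_eq_two_pow_mul (hpa : p % 2 ^ (a + 2) = 2 ^ (a + 1) + 1) : ∃ t, p = 2 ^ (a + 1) * (2 * t + 1) + 1 := by
  refine ⟨p / 2 ^ (a + 2), ?_⟩
  have h := Nat.div_add_mod p (2 ^ (a + 2))
  rw [hpa] at h
  have h2 : (2 : ℕ) ^ (a + 2) = 2 * 2 ^ (a + 1) := by rw [pow_succ]; ring
  rw [h2] at h ⊢
  linarith

/-- **`π_R ∘ ρ̃ = π_R`**: `r^{2p−1} = r` in `R` because `r^{2^{a+1}} = 1` and `2^{a+1} ∣ 2p − 2`. [folklore] -/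
theorem liftR_rho_eq (hp : p.Prime) (hp2 : p ≠ 2) (hpa : p % 2 ^ (a + 2) = 2 ^ (a + 1) + 1)
    (Z : AdjoinRoot (cyclotomic (2 ^ (a + 1) * p) ℤ)) :
    AdjoinRoot.lift (Int.castRingHom _) (AdjoinRoot.root (X ^ 2 ^ a + 1 : (ZMod p)[X])) (eval₂_cyclotomic_R hp hp2)
        (AdjoinRoot.lift (algebraMap ℤ _) (AdjoinRoot.root (cyclotomic (2 ^ (a + 1) * p) ℤ) ^ (2 * p - 1))
          (eval₂_root_pow_cyclotomic hp.pos (coprime_two_mul_sub_one hp.pos)) Z) =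
      AdjoinRoot.lift (Int.castRingHom _) (AdjoinRoot.root (X ^ 2 ^ a + 1 : (ZMod p)[X])) (eval₂_cyclotomic_R hp hp2) Z := by
  obtain ⟨t, ht⟩ := exists_eq_two_pow_mul hpa
  have key := CyclotomicFourP.ringHom_ext (T := AdjoinRoot (X ^ 2 ^ a + 1 : (ZMod p)[X]))
    (φ₁ := (AdjoinRoot.lift (Int.castRingHom _) (AdjoinRoot.root (X ^ 2 ^ a + 1 : (ZMod p)[X]))
      (eval₂_cyclotomic_R hp hp2)).comp
      (AdjoinRoot.lift (algebraMap ℤ _) (AdjoinRoot.root (cyclotomic (2 ^ (a + 1) * p) ℤ) ^ (2 * p - 1))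
        (eval₂_root_pow_cyclotomic hp.pos (coprime_two_mul_sub_one hp.pos))))
    (φ₂ := AdjoinRoot.lift (Int.castRingHom _) (AdjoinRoot.root (X ^ 2 ^ a + 1 : (ZMod p)[X]))
      (eval₂_cyclotomic_R hp hp2)) (by
      rw [RingHom.comp_apply, AdjoinRoot.lift_root, map_pow, AdjoinRoot.lift_root,
        show 2 * p - 1 = 2 ^ (a + 1) * (2 * (2 * t + 1)) + 1 by zify [show 1 ≤ 2 * p by omega]; rw [ht]; push_cast; ring, pow_succ, pow_mul,
        rootR_pow, one_pow, one_mul])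
  exact DFunLike.congr_fun key Z

/-- **`π_s ∘ ρ̃ = π_s`**: `s^{2p−1} = s`. [folklore] -/
theorem lift_rho_eq (hp : p.Prime) (hp2 : p ≠ 2) (hpa : p % 2 ^ (a + 2) = 2 ^ (a + 1) + 1) {s : ZMod p}
    (hs : s ^ 2 ^ a = -1) (Z : AdjoinRoot (cyclotomic (2 ^ (a + 1) * p) ℤ)) :
    AdjoinRoot.lift (Int.castRingHom (ZMod p)) s (eval₂_cyclotomic_s hp hp2 hs)
        (AdjoinRoot.lift (algebraMap ℤ _) (AdjoinRoot.root (cyclotomic (2 ^ (a + 1) * p) ℤ) ^ (2 * p - 1))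
          (eval₂_root_pow_cyclotomic hp.pos (coprime_two_mul_sub_one hp.pos)) Z) =
      AdjoinRoot.lift (Int.castRingHom (ZMod p)) s (eval₂_cyclotomic_s hp hp2 hs) Z := by
  obtain ⟨t, ht⟩ := exists_eq_two_pow_mul hpa
  have hs2 : s ^ 2 ^ (a + 1) = 1 := by rw [pow_succ, pow_mul, hs, neg_one_sq]
  have key := CyclotomicFourP.ringHom_ext (T := ZMod p)
    (φ₁ := (AdjoinRoot.lift (Int.castRingHom (ZMod p)) s (eval₂_cyclotomic_s hp hp2 hs)).comp
      (AdjoinRoot.lift (algebraMap ℤ _) (AdjoinRoot.root (cyclotomic (2 ^ (a + 1) * p) ℤ) ^ (2 * p - 1))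
        (eval₂_root_pow_cyclotomic hp.pos (coprime_two_mul_sub_one hp.pos))))
    (φ₂ := AdjoinRoot.lift (Int.castRingHom (ZMod p)) s (eval₂_cyclotomic_s hp hp2 hs)) (by
      rw [RingHom.comp_apply, AdjoinRoot.lift_root, map_pow, AdjoinRoot.lift_root,
        show 2 * p - 1 = 2 ^ (a + 1) * (2 * (2 * t + 1)) + 1 by zify [show 1 ≤ 2 * p by omega]; rw [ht]; push_cast; ring, pow_succ, pow_mul, hs2,
        one_pow, one_mul])
  exact DFunLike.congr_fun key Z

/-- `π_s(μ^{pj})^{2^a} = −1` for `j` odd (`p ≡ 1 (mod 2^{a+1})`). [folklore] -/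
theorem lift_root_pow_pow (hp : p.Prime) (hp2 : p ≠ 2) (hpa : p % 2 ^ (a + 2) = 2 ^ (a + 1) + 1) {s : ZMod p}
    (hs : s ^ 2 ^ a = -1) {j : ℕ} (hj : Odd j) :
    (AdjoinRoot.lift (Int.castRingHom (ZMod p)) s (eval₂_cyclotomic_s hp hp2 hs)
      (AdjoinRoot.root (cyclotomic (2 ^ (a + 1) * p) ℤ) ^ (p * j))) ^ 2 ^ a = -1 := by
  obtain ⟨t, ht⟩ := exists_eq_two_pow_mul hpa
  have hs2 : s ^ 2 ^ (a + 1) = 1 := by rw [pow_succ, pow_mul, hs, neg_one_sq]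
  have hsp : s ^ p = s := by
    rw [show s ^ p = s ^ (2 ^ (a + 1) * (2 * t + 1) + 1) from by rw [← ht], pow_succ, pow_mul, hs2, one_pow, one_mul]
  rw [map_pow, AdjoinRoot.lift_root, pow_mul, hsp, ← pow_mul, mul_comm, pow_mul, hs]
  exact hj.neg_one_pow

/-! ## §2 One `g`-adic step -/

/-- **Peeling one factor of `g = 1 + μ^{2^a}`.** [cite: Washington1997, Prop. 2.8] -/
theorem peel (hp : p.Prime) (hpa : p % 2 ^ (a + 2) = 2 ^ (a + 1) + 1) (k : ℕ)
    (Z V : AdjoinRoot (cyclotomic (2 ^ (a + 1) * p) ℤ))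
    (hZ : Z * AdjoinRoot.lift (algebraMap ℤ _) (AdjoinRoot.root (cyclotomic (2 ^ (a + 1) * p) ℤ) ^ (2 * p - 1))
      (eval₂_root_pow_cyclotomic hp.pos (coprime_two_mul_sub_one hp.pos)) Z =
      (1 + AdjoinRoot.root (cyclotomic (2 ^ (a + 1) * p) ℤ) ^ 2 ^ a) ^ (2 * (k + 1)) * V) :
    ∃ Z₁ : AdjoinRoot (cyclotomic (2 ^ (a + 1) * p) ℤ),
      Z₁ * AdjoinRoot.lift (algebraMap ℤ _) (AdjoinRoot.root (cyclotomic (2 ^ (a + 1) * p) ℤ) ^ (2 * p - 1))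
        (eval₂_root_pow_cyclotomic hp.pos (coprime_two_mul_sub_one hp.pos)) Z₁ =
      (1 + AdjoinRoot.root (cyclotomic (2 ^ (a + 1) * p) ℤ) ^ 2 ^ a) ^ (2 * k) *
        ((-(-(AdjoinRoot.root (cyclotomic (2 ^ (a + 1) * p) ℤ)) ^ 2 ^ a)) * V) := by
  have hp2 : p ≠ 2 := by
    rintro rfl
    have : 2 % 2 ^ (a + 2) = 2 := Nat.mod_eq_of_lt (by
      have : 2 ^ 2 ≤ 2 ^ (a + 2) := Nat.pow_le_pow_right (by norm_num) (by omega); omega)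
    rw [this] at hpa
    have : 2 ≤ 2 ^ (a + 1) := by
      have : 2 ^ 1 ≤ 2 ^ (a + 1) := Nat.pow_le_pow_right (by norm_num) (by omega); simpa using this
    omega
  haveI := isDomain (a := a) hp.pos
  set μ := AdjoinRoot.root (cyclotomic (2 ^ (a + 1) * p) ℤ) with hμ_def
  set ρ := AdjoinRoot.lift (algebraMap ℤ _) (μ ^ (2 * p - 1))
    (eval₂_root_pow_cyclotomic hp.pos (coprime_two_mul_sub_one hp.pos)) with hρ_def
  set πR := AdjoinRoot.lift (Int.castRingHom _) (AdjoinRoot.root (X ^ 2 ^ a + 1 : (ZMod p)[X]))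
    (eval₂_cyclotomic_R (a := a) hp hp2) with hπR_def
  -- `π_R(Z)² = 0`, hence `π_R(Z) = 0`
  have hvan : πR Z = 0 := by
    have h := congrArg πR hZ
    rw [map_mul, hπR_def, liftR_rho_eq hp hp2 hpa, map_mul, map_pow, liftR_one_add_root_pow hp hp2,
      zero_pow (by omega), zero_mul] at h
    exact eq_zero_of_sq_eq_zero_R hp hp2 _ (by rw [pow_two]; exact h)
  obtain ⟨Z₁, rfl⟩ := exists_eq_mul_of_liftR_eq_zero hp hp2 Z hvan
  refine ⟨Z₁, ?_⟩
  obtain ⟨hρg, hinv⟩ := one_add_root_pow_eq (a := a) hp hp2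
  have hρμ : ρ (1 + μ ^ 2 ^ a) = 1 + (μ ^ (2 * p - 1)) ^ 2 ^ a := by
    rw [map_add, map_one, map_pow, hρ_def, AdjoinRoot.lift_root]
  rw [map_mul, hρμ, hρg] at hZ
  have hg := one_add_root_pow_ne_zero (a := a) hp hp2
  have h2 : (1 + μ ^ 2 ^ a) ^ 2 * ((∑ m ∈ Finset.range (p - 1), (-μ ^ 2 ^ a) ^ m) * (Z₁ * ρ Z₁)) =
      (1 + μ ^ 2 ^ a) ^ 2 * ((1 + μ ^ 2 ^ a) ^ (2 * k) * V) := by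
    have e : (1 + μ ^ 2 ^ a) ^ (2 * (k + 1)) = (1 + μ ^ 2 ^ a) ^ 2 * (1 + μ ^ 2 ^ a) ^ (2 * k) := by
      rw [← pow_add]; congr 1; ring
    rw [e] at hZ
    linear_combination hZ
  have h3 := mul_left_cancel₀ (pow_ne_zero 2 hg) h2
  have h4 := congrArg (fun x => -(-μ ^ 2 ^ a) * x) h3
  rw [← mul_assoc, mul_comm (-(-μ ^ 2 ^ a)), hinv, one_mul] at h4
  rw [h4]
  ring

/-- **Iterated peeling.** [cite: Washington1997, Prop. 2.8] -/
theorem peel_iter (hp : p.Prime) (hpa : p % 2 ^ (a + 2) = 2 ^ (a + 1) + 1) :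
    ∀ (m : ℕ) (Z V : AdjoinRoot (cyclotomic (2 ^ (a + 1) * p) ℤ)),
      Z * AdjoinRoot.lift (algebraMap ℤ _) (AdjoinRoot.root (cyclotomic (2 ^ (a + 1) * p) ℤ) ^ (2 * p - 1))
        (eval₂_root_pow_cyclotomic hp.pos (coprime_two_mul_sub_one hp.pos)) Z =
        (1 + AdjoinRoot.root (cyclotomic (2 ^ (a + 1) * p) ℤ) ^ 2 ^ a) ^ (2 * m) * V →
      ∃ Z' : AdjoinRoot (cyclotomic (2 ^ (a + 1) * p) ℤ),
        Z' * AdjoinRoot.lift (algebraMap ℤ _) (AdjoinRoot.root (cyclotomic (2 ^ (a + 1) * p) ℤ) ^ (2 * p - 1))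
          (eval₂_root_pow_cyclotomic hp.pos (coprime_two_mul_sub_one hp.pos)) Z' =
        (-(-(AdjoinRoot.root (cyclotomic (2 ^ (a + 1) * p) ℤ)) ^ 2 ^ a)) ^ m * V := by
  intro m
  induction m with
  | zero =>
    intro Z V h
    exact ⟨Z, by rw [h, mul_zero, pow_zero, one_mul, pow_zero, one_mul]⟩
  | succ m ih =>
    intro Z V h
    obtain ⟨Z₁, h₁⟩ := peel hp hpa m Z V h
    obtain ⟨Z', h'⟩ := ih Z₁ _ h₁
    exact ⟨Z', by rw [h', ← mul_assoc, ← pow_succ]⟩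

/-! ## §3 The descent -/

/-- **THE DESCENT** (`p ≡ 2^{a+1} + 1 (mod 2^{a+2})`, `s^{2^a} = −1`, `j` odd): no `n ≥ 1`, `Z, U ∈ Λ`, `c ∈ 𝔽_pˣ` with
`π_s(U) = c²` satisfy `Z ρ̃(Z) = n² μ^{pj} U`. [cite: FeinGordonSmith1971, pp. 310–315] -/
theorem descent (hp : p.Prime) (hp2 : p ≠ 2) (hpa : p % 2 ^ (a + 2) = 2 ^ (a + 1) + 1) {s : ZMod p}
    (hs : s ^ 2 ^ a = -1) {j : ℕ} (hj : Odd j) :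
    ∀ (n : ℕ), 0 < n → ∀ (Z U : AdjoinRoot (cyclotomic (2 ^ (a + 1) * p) ℤ)) (c : ZMod p), c ≠ 0 →
      AdjoinRoot.lift (Int.castRingHom (ZMod p)) s (eval₂_cyclotomic_s hp hp2 hs) U = c ^ 2 →
      Z * AdjoinRoot.lift (algebraMap ℤ _) (AdjoinRoot.root (cyclotomic (2 ^ (a + 1) * p) ℤ) ^ (2 * p - 1))
        (eval₂_root_pow_cyclotomic hp.pos (coprime_two_mul_sub_one hp.pos)) Z =
        (n : AdjoinRoot (cyclotomic (2 ^ (a + 1) * p) ℤ)) ^ 2 *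
          (AdjoinRoot.root (cyclotomic (2 ^ (a + 1) * p) ℤ) ^ (p * j) * U) →
      False := by
  haveI := isDomain (a := a) hp.pos
  haveI : Fact p.Prime := ⟨hp⟩
  obtain ⟨t, ht⟩ := exists_eq_two_pow_mul hpa
  set μ := AdjoinRoot.root (cyclotomic (2 ^ (a + 1) * p) ℤ) with hμ_def
  set ρ := AdjoinRoot.lift (algebraMap ℤ _) (μ ^ (2 * p - 1))
    (eval₂_root_pow_cyclotomic hp.pos (coprime_two_mul_sub_one hp.pos)) with hρ_def
  set π := AdjoinRoot.lift (Int.castRingHom (ZMod p)) s (eval₂_cyclotomic_s hp hp2 hs) with hπ_def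
  have hπρ : ∀ Z, π (ρ Z) = π Z := lift_rho_eq hp hp2 hpa hs
  have hω : (π (μ ^ (p * j))) ^ 2 ^ a = -1 := lift_root_pow_pow hp hp2 hpa hs hj
  set ε := ∏ j ∈ Finset.range (p - 1), ∑ m ∈ Finset.range (j + 1), (-μ ^ 2 ^ a) ^ m with hε_def
  have hpε : ((p : ℕ) : AdjoinRoot (cyclotomic (2 ^ (a + 1) * p) ℤ)) = (1 + μ ^ 2 ^ a) ^ (p - 1) * ε :=
    prime_eq_pow_mul hp hp2
  have hπε : π ε ≠ 0 := lift_eps_ne_zero hp hp2 hs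
  have hπη : π (-(-μ ^ 2 ^ a)) = -1 := by rw [map_neg, hπ_def, lift_eta hp hp2 hs]
  intro n
  induction n using Nat.strong_induction_on with
  | _ n ih =>
  intro hn Z U c hc hU hrel
  by_cases hpn : p ∣ n
  · obtain ⟨n', rfl⟩ := hpn
    have hn' : 0 < n' := Nat.pos_of_mul_pos_left hn
    have hrel' : Z * ρ Z = (1 + μ ^ 2 ^ a) ^ (2 * (p - 1)) * (ε ^ 2 * ((n' : AdjoinRoot (cyclotomic (2 ^ (a + 1) * p) ℤ)) ^ 2 *
        (μ ^ (p * j) * U))) := by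
      rw [hrel, Nat.cast_mul, hpε]; ring
    obtain ⟨Z', hZ'⟩ := peel_iter hp hpa (p - 1) Z _ hrel'
    obtain ⟨h2, hh2⟩ := hp.even_sub_one hp2
    refine ih n' (by have := hp.two_le; nlinarith) hn' Z' ((-(-μ ^ 2 ^ a)) ^ (p - 1) * ε ^ 2 * U)
      ((-1) ^ h2 * π ε * c) (mul_ne_zero (mul_ne_zero (pow_ne_zero _ (neg_ne_zero.2 one_ne_zero)) hπε) hc) ?_ ?_
    · rw [map_mul, map_mul, map_pow, map_pow, hπη, hU, hh2]; ring
    · rw [hZ']; ring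
  · have hnz : ((n : ℕ) : ZMod p) ≠ 0 := by rwa [Ne, ZMod.natCast_eq_zero_iff]
    have h := congrArg π hrel
    rw [map_mul, hπρ, map_mul, map_mul, map_pow, map_natCast, hU] at h
    set x : ZMod p := π Z / ((n : ZMod p) * c) with hx_def
    have hx2 : x ^ 2 = π (μ ^ (p * j)) := by
      rw [hx_def, div_pow, div_eq_iff (pow_ne_zero 2 (mul_ne_zero hnz hc))]
      linear_combination h
    have hx4 : x ^ 2 ^ (a + 1) = -1 := by rw [pow_succ', pow_mul, hx2, hω]
    have hx0 : x ≠ 0 := by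
      intro h0
      rw [h0, zero_pow (by positivity)] at hx4
      norm_num at hx4
    have hF := ZMod.pow_card_sub_one_eq_one hx0
    rw [show p - 1 = 2 ^ (a + 1) * (2 * t + 1) by rw [ht]; omega, pow_mul, hx4,
      (show Odd (2 * t + 1) from ⟨t, rfl⟩).neg_one_pow] at hF
    have h2 : (2 : ZMod p) = 0 := by linear_combination -hF
    rw [show (2 : ZMod p) = ((2 : ℕ) : ZMod p) by norm_num, ZMod.natCast_eq_zero_iff] at h2
    exact hp2 ((Nat.prime_dvd_prime_iff_eq hp Nat.prime_two).1 h2)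

end Summit.HodgeConjecture.CorCM.CyclotomicTwoPowerP

end
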